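import Mathlib
import HarnessLib
import Summits.CriticalPhenomena.Ising3DConformalLimit.Theorems.HyperoctahedralRPCriticalCorrNineMirrorRP
import Literature.Probability.LatticeModels.TwoPointGradientEstimate
import Literature.Probability.LatticeModels.HighDimPointwiseTriviality
import Literature.Probability.LatticeModels.PlusFreeComparison
import Literature.Probability.LatticeModels.CriticalTwoPointLower

/-!
# The gradient estimate across a site mirror of `ℤ³` (route MirrorHoelderCompactness, support of
item `NineMirrorGradient`, stmt-CriticalPhenomena-6156 — the mirror engine)

For `G = ⟨σ₀σ_z⟩⁺_{β_c(3)}` (`criticalTwoPoint 3`) and an additive site mirror `θ` of `ℤ³` with level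
`ℓ` whose two-point kernel `(a, b) ↦ G(y_b − θ y_a)` is positive semidefinite on `{ℓ > 0}` — the
nine site mirrors through the origin, `criticalCorrNineMirrorRP_proof` (FILS 1978) — and a lattice
vector `u` with `θ u = −u`, `e − θ e = u` (`u` = the normal step, `e = e_i`):
`G(z) − G(z + u) ≤ (4/s)·g(⌊s/8⌋)` for `s = ℓ z ≥ 1`, `g(n) = G(n e₀)` (`mirror_gradient`). The file
`MirrorHoelderCompactnessNineMirrorGradient` instantiates it on the diagonal and anti-diagonal
mirrors and adds the axis case and the signs.

## Proof (Aizenman–Duminil-Copin 2021 §5.5, proof of Prop. 5.9, transported to a general mirror)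

Reflection positivity evaluated on the four points `p + N e + δ u`, `q + N e + δ u` (`δ ∈ {0,1}`,
coefficients `(1, −1, σ, −σ)`) is, by `e − θ e = u` and `θ u = −u`, the second difference at `N` of
`φ^σ(n) = G(p − θp + nu) + G(q − θq + nu) + σ(G(q − θp + nu) + G(p − θq + nu))`, so `φ^{±}` are
CONVEX (`mirror_convex`) — the finite-support substitute (as in the tree's
`DCPGradient.smeared_axis_nonneg_convex` for the axis) for the Stieltjes / transfer-matrix
representation of ADC21 Prop. 5.3. A convex bounded sequence is nonincreasing with increments
`≤ φ(j)/(n − j + 1)` (`DCPGradient.sub_succ_le_div_of_convex`), and `φ⁺ − φ⁻` isolates the cross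
term (`cross_increment_le`). With `p = e`, `q = z + e − (n+1)u`, `n = ⌊(s−2)/2⌋` the cross term at
`n, n+1` is `G(z), G(z+u)`; with `j = ⌊n/2⌋`, `4(n − j + 1) ≥ s` and Messager–Miracle-Solé
(`G(y) ≤ g(‖y‖_∞)`, `twoPointFree_le_axis_of_mem_sphere'`) bounds `φ⁺(j) ≤ 4 g(⌊s/8⌋)`. The plus
and free states agree at `β_c(3)` (`m*(β_c) = 0`, ADS 2015; Lebowitz–Martin-Löf).

References: M. Aizenman, H. Duminil-Copin, Ann. of Math. 194 (2021) = arXiv:1912.07973, §5.3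
Prop. 5.3, §5.5 Prop. 5.9; H. Duminil-Copin, R. Panis, CMP 406 (2025), eq. (1.11); J. Fröhlich,
R. Israel, E. Lieb, B. Simon, CMP 62 (1978) §2–3; A. Messager, S. Miracle-Solé, J. Stat. Phys. 17
(1977). No definitions are introduced.
-/

noncomputable section

namespace Summit.CriticalPhenomena.Ising3DConformalLimit.MirrorHoelderNineMirrorGradient

open Finset
open Literature.Probability.LatticeModels
open Summit.CriticalPhenomena.Ising3DConformalLimit.HyperoctahedralRPNineMirror

/-! ### A. Convex bounded sequences: isolating a cross term -/

/-- **Cross-term increments from two convex sequences.** If `φ⁺ = A + B + 2K` and `φ⁻ = A + B − 2K`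
are convex on `ℕ`, with `0 ≤ A, B, K ≤ 1`, then `K(n) − K(n+1) ≤ (A j + B j + 2 K j)/(4 (n − j + 1))`
for `j ≤ n`: `φ⁻` is convex and bounded, hence nonincreasing, and
`4(K n − K (n+1)) = (φ⁺ n − φ⁺ (n+1)) − (φ⁻ n − φ⁻ (n+1)) ≤ φ⁺ n − φ⁺ (n+1) ≤ φ⁺ j/(n − j + 1)`
(`DCPGradient.sub_succ_le_div_of_convex`). [folklore] -/
theorem cross_increment_le {A B K : ℕ → ℝ}
    (hA0 : ∀ n, 0 ≤ A n) (hB0 : ∀ n, 0 ≤ B n) (hK0 : ∀ n, 0 ≤ K n)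
    (hA1 : ∀ n, A n ≤ 1) (hB1 : ∀ n, B n ≤ 1)
    (hconv : ∀ σ : ℝ, (σ = 1 ∨ σ = -1) → ∀ n : ℕ,
      2 * (A (n + 1) + B (n + 1) + 2 * σ * K (n + 1)) ≤
        (A n + B n + 2 * σ * K n) + (A (n + 2) + B (n + 2) + 2 * σ * K (n + 2)))
    {j n : ℕ} (hjn : j ≤ n) :
    K n - K (n + 1) ≤ (A j + B j + 2 * K j) / (4 * ((n : ℝ) - j + 1)) := by
  set φp : ℕ → ℝ := fun m => A m + B m + 2 * K m with hφp
  set φm : ℕ → ℝ := fun m => A m + B m - 2 * K m with hφm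
  have hpc : ∀ m, 2 * φp (m + 1) ≤ φp m + φp (m + 2) := fun m => by
    have := hconv 1 (Or.inl rfl) m
    simp only [hφp]
    linarith
  have hmc : ∀ m, 2 * φm (m + 1) ≤ φm m + φm (m + 2) := fun m => by
    have := hconv (-1) (Or.inr rfl) m
    simp only [hφm]
    linarith
  have hp0 : ∀ m, 0 ≤ φp m := fun m => by
    simp only [hφp]
    linarith [hA0 m, hB0 m, hK0 m]
  have hmB : ∀ m, φm m ≤ 2 := fun m => by
    simp only [hφm]
    linarith [hA1 m, hB1 m, hK0 m]
  have hanti : φm (n + 1) ≤ φm n := DCPGradient.succ_le_of_convex_bdd hmc hmB n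
  have hinc : φp n - φp (n + 1) ≤ φp j / ((n : ℝ) - j + 1) :=
    DCPGradient.sub_succ_le_div_of_convex hpc hp0 hjn
  have hden : (0 : ℝ) < (n : ℝ) - j + 1 := by
    have : (j : ℝ) ≤ n := by exact_mod_cast hjn
    linarith
  have hK : 4 * (K n - K (n + 1)) = (φp n - φp (n + 1)) - (φm n - φm (n + 1)) := by
    simp only [hφp, hφm]; ring
  have h4 : 4 * (K n - K (n + 1)) ≤ φp j / ((n : ℝ) - j + 1) := by linarith
  rw [le_div_iff₀ (by positivity)]
  calc (K n - K (n + 1)) * (4 * ((n : ℝ) - j + 1))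
        = (4 * (K n - K (n + 1))) * ((n : ℝ) - j + 1) := by ring
    _ ≤ (φp j / ((n : ℝ) - j + 1)) * ((n : ℝ) - j + 1) :=
        mul_le_mul_of_nonneg_right h4 hden.le
    _ = φp j := div_mul_cancel₀ _ hden.ne'
    _ = A j + B j + 2 * K j := by simp only [hφp]

/-! ### B. The critical two-point dictionary on `ℤ³` -/

/-- `m*(β_c(3)) = 0` (Aizenman–Duminil-Copin–Sidoravicius 2015; tree:
`spontaneousMagnetization_criticalBeta_eq_zero_holds`). [cite: AizenmanDuminilCopinSidoraviciusCMP2015, Thm. 1.2 with Cor. 1.5 (1)] -/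
theorem magnetization_criticalBeta_three : spontaneousMagnetization 3 (criticalBeta 3) = 0 :=
  spontaneousMagnetization_criticalBeta_eq_zero_holds (d := 3) (by norm_num)

/-- At `β_c(3)` the free and plus two-point functions coincide:
`⟨σ₀σ_x⟩^∅_{β_c} = ⟨σ₀σ_x⟩⁺_{β_c} = criticalTwoPoint 3 x` (Lebowitz–Martin-Löf, `m*(β_c) = 0`). [folklore] -/
theorem free_eq_crit (x : Site 3) :
    twoPointFree 3 (criticalBeta 3) x = criticalTwoPoint 3 x :=
  twoPointFree_eq_twoPointPlus_of_spontaneousMagnetization_eq_zero (criticalBeta_nonneg 3)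
    magnetization_criticalBeta_three x

/-- Invariance of `criticalTwoPoint 3` under signed coordinate permutations. [folklore] -/
theorem crit_signedPerm (π : Equiv.Perm (Fin 3)) (ε : Fin 3 → ℤˣ) (x : Site 3) :
    criticalTwoPoint 3 (Site.signedPerm π ε x) = criticalTwoPoint 3 x :=
  twoPointPlus_signedPerm _ π ε x

/-- The axial critical two-point function is nonincreasing: `g(m + k) ≤ g(m)` for `m, k ∈ ℕ`,
`g(n) = ⟨σ₀σ_{n e₀}⟩_{β_c}` (Messager–Miracle-Solé). [folklore] -/
theorem crit_axis_add_le (m k : ℕ) :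
    criticalTwoPoint 3 (Pi.single 0 (((m + k : ℕ)) : ℤ)) ≤ criticalTwoPoint 3 (Pi.single 0 (m : ℤ)) := by
  rw [← free_eq_crit, ← free_eq_crit]
  have h := twoPointFree_add_single_le (criticalBeta_nonneg 3) (Pi.single 0 (m : ℤ) : Site 3) 0 (by simp) k
  rwa [← Pi.single_add, show ((m : ℤ) + (k : ℤ)) = ((m + k : ℕ) : ℤ) by push_cast; ring] at h

/-- `g(n) ≤ g(m)` for `m ≤ n`. [folklore] -/
theorem crit_axis_antitone {m n : ℕ} (h : m ≤ n) :
    criticalTwoPoint 3 (Pi.single 0 (n : ℤ)) ≤ criticalTwoPoint 3 (Pi.single 0 (m : ℤ)) := by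
  obtain ⟨k, rfl⟩ := Nat.exists_eq_add_of_le h
  exact crit_axis_add_le m k

/-- **Messager–Miracle-Solé comparison with the axis**: `G(y) ≤ g(m)` whenever `m ≤ ‖y‖_∞`
(`G(y) ≤ g(‖y‖_∞)`, `twoPointFree_le_axis_of_mem_sphere'`, and monotonicity of `g`). [folklore] -/
theorem crit_le_axis_of_le_supNorm (y : Site 3) {m : ℕ} (hm : m ≤ Site.supNorm y) :
    criticalTwoPoint 3 y ≤ criticalTwoPoint 3 (Pi.single 0 (m : ℤ)) := by
  have h := twoPointFree_le_axis_of_mem_sphere' (criticalBeta_nonneg 3) (d := 3) (by norm_num)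
    (self_mem_sphere y)
  rw [free_eq_crit, free_eq_crit] at h
  exact h.trans (crit_axis_antitone hm)

/-! ### C. Reflection positivity of the two-point kernel in the nine site mirrors -/

/-- **The two-point RP kernel.** For each of the nine site mirrors `(θ, ℓ)` of `ℤ³` through the
origin and finitely many sites `y_a` strictly on the positive side, the matrix
`G(y_b − θ y_a)` is positive semidefinite: `0 ≤ Σ_{a,b} c_a c_b G(y_b − θ y_a)` — the case of
one-point configurations in `criticalCorrNineMirrorRP_proof` (FILS 1978, §3 Thm. 3.1), with
`⟨σ_{θy_a} σ_{y_b}⟩_{β_c} = G(y_b − θ y_a)` (`criticalCorr_two_pair`). [cite: FrohlichEtAl1978, §3 Thm 3.1] -/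
theorem rp_kernel (θ : Site 3 → Site 3) (ℓ : Site 3 → ℤ)
    (hθℓ : ∃ i j : Fin 3, i ≠ j ∧ ((θ = fun x => Function.update x i (-x i)) ∧ (ℓ = fun x => x i) ∨
      (θ = fun x => x ∘ Equiv.swap i j) ∧ (ℓ = fun x => x i - x j) ∨
      (θ = fun x => Function.update (Function.update x i (-x j)) j (-x i)) ∧ (ℓ = fun x => x i + x j)))
    {m : ℕ} (y : Fin m → Site 3) (c : Fin m → ℝ) (hy : ∀ a, 0 < ℓ (y a)) :
    0 ≤ ∑ a, ∑ b, c a * c b * criticalTwoPoint 3 (y b - θ (y a)) := by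
  have h := criticalCorrNineMirrorRP_proof θ ℓ hθℓ m (fun _ => 1) (fun a _ => y a) c (fun a _ => hy a)
  refine h.trans_eq (Finset.sum_congr rfl fun a _ => Finset.sum_congr rfl fun b _ => ?_)
  congr 1
  rw [← criticalCorr_two_pair]
  congr 1
  funext k
  refine Fin.addCases (fun k0 => ?_) (fun k1 => ?_) k
  · rw [Fin.append_left]
    have : k0 = 0 := Subsingleton.elim _ _
    subst this
    rfl
  · rw [Fin.append_right]
    have : k1 = 0 := Subsingleton.elim _ _
    subst this
    rfl

/-! ### D. A site mirror with its normal `u`: convexity of the smeared sequences -/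

/-- **Convexity from reflection positivity (the Hankel structure).** Let `θ` be an additive site
mirror with RP kernel `G(y_b − θ y_a) ⪰ 0` on `{ℓ > 0}` (`ℓ` additive), `u` a lattice vector with
`θ u = −u` and `e` one with `θ e = e − u`, `ℓ u, ℓ e ≥ 0`. For `p, q` strictly positive and
`σ = ±1`, the quadratic form of the kernel on the four points `p + N e`, `p + N e + u`, `q + N e`,
`q + N e + u` with coefficients `(1, −1, σ, −σ)` is the second difference at `N` of
`φ^σ(n) = G(p − θp + nu) + G(q − θq + nu) + σ (G(q − θp + nu) + G(p − θq + nu))`, which is therefore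
convex — the finite-support content of the spectral representation of Aizenman–Duminil-Copin 2021,
Prop. 5.3 / §5.5, for the direction `u`. [cite: AizenmanDuminilCopinAnnals2021, arXiv:1912.07973 §5.3 Prop. 5.3 and §5.5] -/
theorem mirror_convex (θ : Site 3 →+ Site 3) (ℓ : Site 3 →+ ℤ) (u e : Site 3)
    (hRP : ∀ (m : ℕ) (y : Fin m → Site 3) (c : Fin m → ℝ), (∀ a, 0 < ℓ (y a)) →
      0 ≤ ∑ a, ∑ b, c a * c b * criticalTwoPoint 3 (y b - θ (y a)))
    (hθu : θ u = -u) (hθe : θ e = e - u) (hℓu : 0 ≤ ℓ u) (hℓe : 0 ≤ ℓ e)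
    {p q : Site 3} (hp : 0 < ℓ p) (hq : 0 < ℓ q) {σ : ℝ} (hσ : σ = 1 ∨ σ = -1) (N : ℕ) :
    2 * (criticalTwoPoint 3 (p - θ p + ((N + 1 : ℕ) : ℤ) • u) +
          criticalTwoPoint 3 (q - θ q + ((N + 1 : ℕ) : ℤ) • u) +
          σ * (criticalTwoPoint 3 (q - θ p + ((N + 1 : ℕ) : ℤ) • u) +
            criticalTwoPoint 3 (p - θ q + ((N + 1 : ℕ) : ℤ) • u))) ≤
      (criticalTwoPoint 3 (p - θ p + (N : ℤ) • u) + criticalTwoPoint 3 (q - θ q + (N : ℤ) • u) +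
          σ * (criticalTwoPoint 3 (q - θ p + (N : ℤ) • u) +
            criticalTwoPoint 3 (p - θ q + (N : ℤ) • u))) +
        (criticalTwoPoint 3 (p - θ p + ((N + 2 : ℕ) : ℤ) • u) +
          criticalTwoPoint 3 (q - θ q + ((N + 2 : ℕ) : ℤ) • u) +
          σ * (criticalTwoPoint 3 (q - θ p + ((N + 2 : ℕ) : ℤ) • u) +
            criticalTwoPoint 3 (p - θ q + ((N + 2 : ℕ) : ℤ) • u))) := by
  -- the four points and coefficients
  set y : Fin 4 → Site 3 :=
    ![p + (N : ℤ) • e, p + (N : ℤ) • e + u, q + (N : ℤ) • e, q + (N : ℤ) • e + u] with hy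
  set c : Fin 4 → ℝ := ![1, -1, σ, -σ] with hc
  have hNe : 0 ≤ ℓ ((N : ℤ) • e) := by
    rw [map_zsmul, smul_eq_mul]; positivity
  have h1 : 0 < ℓ (p + (N : ℤ) • e) := by rw [map_add]; linarith
  have h2 : 0 < ℓ (p + (N : ℤ) • e + u) := by rw [map_add, map_add]; linarith
  have h3 : 0 < ℓ (q + (N : ℤ) • e) := by rw [map_add]; linarith
  have h4 : 0 < ℓ (q + (N : ℤ) • e + u) := by rw [map_add, map_add]; linarith
  have hypos : ∀ a, 0 < ℓ (y a) := by
    intro a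
    fin_cases a
    · exact h1
    · exact h2
    · exact h3
    · exact h4
  have hpos := hRP 4 y c hypos
  simp only [Fin.sum_univ_four, hy, hc, Matrix.cons_val_zero, Matrix.cons_val_one, Matrix.head_cons,
    Matrix.cons_val_two, Matrix.tail_cons, Matrix.cons_val_three] at hpos
  -- the sixteen differences
  have k00 : ∀ a b : Site 3, (b + (N : ℤ) • e) - θ (a + (N : ℤ) • e) = (b - θ a) + (N : ℤ) • u := by
    intro a b; ext k
    simp only [map_add, map_zsmul, hθe, Pi.add_apply, Pi.sub_apply, Pi.smul_apply, smul_eq_mul]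
    ring
  have k01 : ∀ a b : Site 3, (b + (N : ℤ) • e + u) - θ (a + (N : ℤ) • e) =
      (b - θ a) + ((N + 1 : ℕ) : ℤ) • u := by
    intro a b; ext k
    simp only [map_add, map_zsmul, hθe, Pi.add_apply, Pi.sub_apply, Pi.smul_apply, smul_eq_mul]
    push_cast; ring
  have k10 : ∀ a b : Site 3, (b + (N : ℤ) • e) - θ (a + (N : ℤ) • e + u) =
      (b - θ a) + ((N + 1 : ℕ) : ℤ) • u := by
    intro a b; ext k
    simp only [map_add, map_zsmul, hθe, hθu, Pi.add_apply, Pi.sub_apply, Pi.smul_apply,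
      Pi.neg_apply, smul_eq_mul]
    push_cast; ring
  have k11 : ∀ a b : Site 3, (b + (N : ℤ) • e + u) - θ (a + (N : ℤ) • e + u) =
      (b - θ a) + ((N + 2 : ℕ) : ℤ) • u := by
    intro a b; ext k
    simp only [map_add, map_zsmul, hθe, hθu, Pi.add_apply, Pi.sub_apply, Pi.smul_apply,
      Pi.neg_apply, smul_eq_mul]
    push_cast; ring
  simp only [k11, k10, k01, k00] at hpos
  rcases hσ with rfl | rfl
  · linarith
  · linarith

/-- **The gradient bound across a site mirror** (the diagonal case of the item, abstract form).
With `θ, ℓ, u, e` as in `mirror_convex`, `θ` an involution leaving `G` invariant, `ℓ ∘ θ = −ℓ`,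
`ℓ u = 2`, `ℓ e = 1` and `ℓ ≤ 2‖·‖_∞`: for every `z` with `s := ℓ z ≥ 1`,
`G(z) − G(z+u) ≤ (4/s) · g(⌊s/8⌋)`. Take `p = e`, `q = z + e − (n+1)u`, `n = ⌊(s−2)/2⌋`: then
`q − θp + nu = z`, the smeared sequences `φ^± = A + B ± 2K` (`K(n) = G(q − θp + nu)`) are convex
(`mirror_convex`), so `K(n) − K(n+1) ≤ φ⁺(j)/(4(n−j+1))` (`cross_increment_le`) with `j = ⌊n/2⌋`,
`4(n − j + 1) ≥ s`, and each of `A(j), B(j), K(j)` is `G` at a point of sup-norm `≥ j + 1 ≥ ⌊s/8⌋`,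
hence `≤ g(⌊s/8⌋)` by Messager–Miracle-Solé. (Aizenman–Duminil-Copin 2021, proof of Prop. 5.9,
transported to a diagonal direction.) [cite: AizenmanDuminilCopinAnnals2021, arXiv:1912.07973 §5.5, proof of Prop. 5.9] -/
theorem mirror_gradient (θ : Site 3 →+ Site 3) (ℓ : Site 3 →+ ℤ) (u e : Site 3)
    (hRP : ∀ (m : ℕ) (y : Fin m → Site 3) (c : Fin m → ℝ), (∀ a, 0 < ℓ (y a)) →
      0 ≤ ∑ a, ∑ b, c a * c b * criticalTwoPoint 3 (y b - θ (y a)))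
    (hθu : θ u = -u) (hθe : θ e = e - u) (hℓu : ℓ u = 2) (hℓe : ℓ e = 1)
    (hθθ : ∀ x, θ (θ x) = x) (hGθ : ∀ x, criticalTwoPoint 3 (θ x) = criticalTwoPoint 3 x)
    (hℓθ : ∀ x, ℓ (θ x) = -ℓ x) (hℓsup : ∀ x, ℓ x ≤ 2 * (Site.supNorm x : ℤ))
    (z : Site 3) (hz : 1 ≤ ℓ z) :
    criticalTwoPoint 3 z - criticalTwoPoint 3 (z + u) ≤
      4 / ((ℓ z : ℤ) : ℝ) * criticalTwoPoint 3 (Pi.single 0 (ℓ z / 8)) := by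
  obtain ⟨S, hS⟩ : ∃ S : ℕ, ℓ z = S := ⟨(ℓ z).toNat, (Int.toNat_of_nonneg (by omega)).symm⟩
  have hS1 : 1 ≤ S := by omega
  have hdiv : ℓ z / 8 = ((S / 8 : ℕ) : ℤ) := by rw [hS]; push_cast; rfl
  rw [hdiv, hS]
  have hG0 : ∀ x, 0 ≤ criticalTwoPoint 3 x := criticalTwoPoint_nonneg'
  have hG1 : ∀ x, criticalTwoPoint 3 x ≤ 1 := criticalTwoPoint_le_one'
  have hSpos : (0 : ℝ) < (S : ℝ) := by exact_mod_cast hS1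
  -- small `s`: the trivial bound
  by_cases hS2 : S < 2
  · have hS' : S = 1 := by omega
    subst hS'
    have h0 : criticalTwoPoint 3 (Pi.single 0 (((1 / 8 : ℕ)) : ℤ)) = 1 := by
      rw [show ((1 / 8 : ℕ) : ℤ) = 0 by norm_num, Pi.single_zero]
      exact criticalTwoPoint_zero'
    rw [h0]
    push_cast
    linarith [hG0 (z + u), hG1 z]
  push Not at hS2
  -- the points
  obtain ⟨n, hn⟩ : ∃ n : ℕ, n = (S - 2) / 2 := ⟨_, rfl⟩
  obtain ⟨j, hj⟩ : ∃ j : ℕ, j = n / 2 := ⟨_, rfl⟩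
  obtain ⟨q, hq⟩ : ∃ q : Site 3, q = z + e - ((n + 1 : ℕ) : ℤ) • u := ⟨_, rfl⟩
  have hℓp : 0 < ℓ e := by rw [hℓe]; exact one_pos
  have hℓq' : ℓ q = S + 1 - 2 * ((n + 1 : ℕ) : ℤ) := by
    rw [hq, map_sub, map_add, map_zsmul, hS, hℓe, hℓu, smul_eq_mul]; ring
  have hℓq : 0 < ℓ q := by rw [hℓq']; push_cast; omega
  -- the sequences
  set A : ℕ → ℝ := fun m => criticalTwoPoint 3 (e - θ e + (m : ℤ) • u) with hA
  set B : ℕ → ℝ := fun m => criticalTwoPoint 3 (q - θ q + (m : ℤ) • u) with hB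
  set K : ℕ → ℝ := fun m => criticalTwoPoint 3 (q - θ e + (m : ℤ) • u) with hK
  -- symmetry of the cross terms
  have hsym : ∀ m : ℕ, criticalTwoPoint 3 (e - θ q + (m : ℤ) • u) = K m := by
    intro m
    have : e - θ q + (m : ℤ) • u = -θ (q - θ e + (m : ℤ) • u) := by
      rw [map_add, map_sub, hθθ, map_zsmul, hθu]
      ext k
      simp only [Pi.add_apply, Pi.sub_apply, Pi.neg_apply, Pi.smul_apply, smul_eq_mul]
      ring
    rw [this, criticalTwoPoint_neg, hGθ]
  -- convexity of `φ^σ`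
  have hconv : ∀ σ : ℝ, (σ = 1 ∨ σ = -1) → ∀ N : ℕ,
      2 * (A (N + 1) + B (N + 1) + 2 * σ * K (N + 1)) ≤
        (A N + B N + 2 * σ * K N) + (A (N + 2) + B (N + 2) + 2 * σ * K (N + 2)) := by
    intro σ hσ N
    have h := mirror_convex θ ℓ u e hRP hθu hθe (by rw [hℓu]; norm_num) (by rw [hℓe]; norm_num)
      hℓp hℓq hσ N
    rw [hsym, hsym, hsym] at h
    simp only [hA, hB, hK]
    rcases hσ with rfl | rfl
    · linarith
    · linarith
  have hjn : j ≤ n := by rw [hj]; exact Nat.div_le_self n 2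
  have hmain := cross_increment_le (A := A) (B := B) (K := K) (fun m => hG0 _) (fun m => hG0 _)
    (fun m => hG0 _) (fun m => hG1 _) (fun m => hG1 _) hconv hjn
  -- identify `K n = G z`, `K (n+1) = G (z+u)`
  have hKn : K n = criticalTwoPoint 3 z := by
    simp only [hK, hq]
    congr 1
    rw [hθe]
    ext k
    simp only [Pi.add_apply, Pi.sub_apply, Pi.smul_apply, smul_eq_mul]
    push_cast; ring
  have hKn1 : K (n + 1) = criticalTwoPoint 3 (z + u) := by
    simp only [hK, hq]
    congr 1
    rw [hθe]
    ext k
    simp only [Pi.add_apply, Pi.sub_apply, Pi.smul_apply, smul_eq_mul]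
    push_cast; ring
  -- size of `A j`, `B j`, `K j` by Messager–Miracle-Solé
  have hjS : S / 8 ≤ j + 1 := by omega
  have hsup : ∀ x : Site 3, 2 * ((j : ℤ) + 1) ≤ ℓ x →
      criticalTwoPoint 3 x ≤ criticalTwoPoint 3 (Pi.single 0 ((S / 8 : ℕ) : ℤ)) := by
    intro x hx
    refine crit_le_axis_of_le_supNorm x (hjS.trans ?_)
    have := hℓsup x
    omega
  have hAj : A j ≤ criticalTwoPoint 3 (Pi.single 0 ((S / 8 : ℕ) : ℤ)) := by
    refine hsup _ ?_
    rw [map_add, map_sub, hℓθ, map_zsmul, hℓu, smul_eq_mul, hℓe]; omega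
  have hBj : B j ≤ criticalTwoPoint 3 (Pi.single 0 ((S / 8 : ℕ) : ℤ)) := by
    refine hsup _ ?_
    rw [map_add, map_sub, hℓθ, map_zsmul, hℓu, smul_eq_mul, hℓq']; push_cast; omega
  have hKj : K j ≤ criticalTwoPoint 3 (Pi.single 0 ((S / 8 : ℕ) : ℤ)) := by
    refine hsup _ ?_
    rw [map_add, map_sub, hℓθ, map_zsmul, hℓu, smul_eq_mul, hℓq', hℓe]; push_cast; omega
  -- the denominator
  have hden : (S : ℝ) ≤ 4 * ((n : ℝ) - j + 1) := by
    have h : S + 4 * j ≤ 4 * n + 4 := by omega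
    have h' : (S : ℝ) + 4 * j ≤ 4 * n + 4 := by exact_mod_cast h
    linarith
  have hDpos : (0 : ℝ) < 4 * ((n : ℝ) - j + 1) := lt_of_lt_of_le hSpos hden
  set g : ℝ := criticalTwoPoint 3 (Pi.single 0 ((S / 8 : ℕ) : ℤ)) with hg
  have hg0 : 0 ≤ g := hG0 _
  rw [hKn, hKn1] at hmain
  calc criticalTwoPoint 3 z - criticalTwoPoint 3 (z + u)
        ≤ (A j + B j + 2 * K j) / (4 * ((n : ℝ) - j + 1)) := hmain
    _ ≤ (4 * g) / (4 * ((n : ℝ) - j + 1)) :=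
        div_le_div_of_nonneg_right (by linarith) hDpos.le
    _ ≤ (4 * g) / (S : ℝ) := div_le_div_of_nonneg_left (by linarith) hSpos hden
    _ = 4 / ((S : ℤ) : ℝ) * g := by push_cast; ring

end Summit.CriticalPhenomena.Ising3DConformalLimit.MirrorHoelderNineMirrorGradient

end
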